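import Summits.CriticalPhenomena.PercolationContinuityZ3.Theorems.PercNearOneGluingNoHeavyLowerTailSahiTangentCubeCheck

/-!
# The tangent inequality `T₃ ≥ 0` on `{0,1}³ × Bool` for EVERY product measure — CERTIFIED by compiled evaluation (`native_decide`)
# (Sahi programme, cell prim-sahi, prover prim-sahi-p2 gen 32)

Support file (`--supports stmt-CriticalPhenomena-4575`, COMPUTATIONAL: one `native_decide`, hence the axiom `Lean.ofReduceBool` on
`checkCubeT_three` and its corollary; nothing else).  For every `p : Fin 3 → [0,1]` and all increasing events `A₀ ⊆ A₁`, `B₀ ⊆ B₁`, `C₀ ⊆ C₁` of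
`Set (Fin 3)` (section pairs of three increasing events of `{0,1}³ × Bool` = `{0,1}⁴` along a coordinate), `T₃ ≥ 0` (the tangent / contraction
inequality `E₃ ≥ q·E₃(·|top)`, memo `FROM-prim-sahi-p2-gen32-TANGENT.md`): `checkCubeT 3 15` of `…SahiTangentCubeCheck` (168 increasing section
pairs, 804 440 sorted triples, 64 base-`2^15` digits each) returns `true` under compiled evaluation (≈ 2 min); independently, an exact Python census
(kit j304007, `prim-sahi-p2/gen32/kit_bern3`) found all 804 440 tensor-Bernstein coefficient vectors nonnegative.  The kernel-checked cases
`m ≤ 2` are in `…SahiTangentCubeLeTwo`.  With equal sections this contains Sahi's `C₃` on `{0,1}³` (kernel theorem `SahiC3Cube.sahiC3_cube_three`)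
and is the `{0,1}³ × Bool` slice of Kahn's conjecture on `{0,1}⁴` (`SahiC3Cube.sahiC3_cube_four`, also `native_decide`).
-/

namespace Summit.CriticalPhenomena.PercolationContinuityZ3.Theorems.SahiTangent

open MeasureTheory Literature.Probability.Percolation Literature.Probability.LatticeModels

/-- The tangent cube check passes in dimension `3`: `20` increasing bitmasks, `168` section pairs, `804 440` sorted triples, base `2^15`
(compiled evaluation, `native_decide`). [this work] -/
theorem checkCubeT_three : checkCubeT 3 15 = true := by native_decide

/-- **The tangent inequality `T₃ ≥ 0` on `{0,1}³` (i.e. on `{0,1}³ × Bool`) for every product measure** (certified: depends on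
`Lean.ofReduceBool` through `checkCubeT_three`). [this work] -/
theorem tangent_cube_three (p : Fin 3 → unitInterval) {A₀ A₁ B₀ B₁ C₀ C₁ : Set (Set (Fin 3))}
    (hA₀ : IsUpperSet A₀) (hA₁ : IsUpperSet A₁) (hB₀ : IsUpperSet B₀) (hB₁ : IsUpperSet B₁) (hC₀ : IsUpperSet C₀) (hC₁ : IsUpperSet C₁)
    (hA : A₀ ⊆ A₁) (hB : B₀ ⊆ B₁) (hC : C₀ ⊆ C₁) :
    0 ≤ 2 * (prodBernoulli p).real (A₀ ∩ B₀ ∩ C₀)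
      + ((prodBernoulli p).real A₁ - (prodBernoulli p).real A₀) * (prodBernoulli p).real (B₁ ∩ C₁)
      + ((prodBernoulli p).real B₁ - (prodBernoulli p).real B₀) * (prodBernoulli p).real (A₁ ∩ C₁)
      + ((prodBernoulli p).real C₁ - (prodBernoulli p).real C₀) * (prodBernoulli p).real (A₁ ∩ B₁)
      + (prodBernoulli p).real A₀ * (prodBernoulli p).real B₁ * (prodBernoulli p).real C₁
      + (prodBernoulli p).real B₀ * (prodBernoulli p).real A₁ * (prodBernoulli p).real C₁
      + (prodBernoulli p).real C₀ * (prodBernoulli p).real A₁ * (prodBernoulli p).real B₁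
      - (prodBernoulli p).real A₁ * (prodBernoulli p).real (B₀ ∩ C₀) - (prodBernoulli p).real B₁ * (prodBernoulli p).real (A₀ ∩ C₀)
      - (prodBernoulli p).real C₁ * (prodBernoulli p).real (A₀ ∩ B₀)
      - 2 * (prodBernoulli p).real A₁ * (prodBernoulli p).real B₁ * (prodBernoulli p).real C₁ :=
  tangent_cube_nonneg_of_checkCubeT checkCubeT_three p hA₀ hA₁ hB₀ hB₁ hC₀ hC₁ hA hB hC

end Summit.CriticalPhenomena.PercolationContinuityZ3.Theorems.SahiTangent
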